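import Mathlib.NumberTheory.DirichletCharacter.GaussSum
import Mathlib.NumberTheory.LegendreSymbol.AddCharacter
import HarnessLib

/-!
# Route `ThetaPartnerAtTwo` (TP2), crux K3 `SignedKatoDivisibilityUpToAtTwo` (item stmt-BirchSwinnertonDyer-20308), line `colemanrat` —
# (R3) «character sums of the Honda logarithms are Gauss sums» (Kobayashi Prop. 8.26), part 1: the CYCLOTOMIC ALGEBRA
# of Gauss sums of prime-power-level Dirichlet characters against `a ↦ ζ^a` (level raising, vanishing, trivial character)

Width seat `bsd-wall-tp2-p2x-w2` g5 (cell `bsd-wall`). HONEST FRAMING: theorems only (no definition, no named fact, no instance,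
no `sorry`); generic algebra over a commutative domain `R` — nothing about any curve, Selmer group or `L`-function is asserted; closes no
item; K3 is NOT settled and BSD is NOT proved by any of this.

## Why this file

After v12 of line `colemanrat` the published input of K3 is the finite-level explicit reciprocity law (ERL_pair / ERL_PAIR,
`…CoreOfLayerErl`, `…OfPubErlPair`) «`ν·P_{n,d_n}(loc s_n) ≡ μ·θ_n (mod ω_n)`», and its honest proof at `p = 2` splits (lead g6,
STATUS 09:32:59Z) into (R1′) Bloch–Kato/Kato-II reciprocity «`⟨x, Q⟩ = Tr(log Q · exp* x)`» (PUB), (R2) Kato Thm. 12.5 (PUB, tree fact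
`Kato2004.exists_eulerSystem_expStar_values`), (R4′) values ⇒ congruence (`CongrModOmegaOfValuesProofs`, landed) and
(R3) = Kobayashi Prop. 8.26 READ AT `2`: for a character `χ` of `G_n = Gal(ℚ_{2,n}/ℚ₂)`, the character sum
`∑_{u ∈ G_n} χ(u)·log_Ê(u·d_n)` of the tree's plus Honda points `d_n = 3(c_{n+2} + σc_{n+2}) − 2c_1` (`…LocalTwoPlusPoints`,
`log c_m = ℓ_m = ∑_{k<m} (−1)^k (ζ_{2^{m−2k}} − 1)/2^k`, `Rank1Residual/Additive/KobayashiTowerPoints.ell`) is an explicit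
multiple of the Gauss sum of `χ`, non-zero only when the conductor exponent of `χ` has the parity of `n + 2`. Since `log` is
Galois-equivariant and `u(ζ_{2^j}) = ζ_{2^j}^{a(u)}`, (R3) is PURE CYCLOTOMIC ALGEBRA: sums `∑_{a ∈ (ℤ/p^N)} χ(a) ζ_{p^M}^{a}` for
characters `χ` mod `p^N` (MulChar convention: `χ = 0` off the units) against roots of unity of LOWER level `p^M`. This file proves the
three facts that evaluate every such sum (any prime `p`, any commutative domain `R`):

* `gaussSum_zmodChar_eq_zero_of_not_factorsThrough` — if `ζ^d = 1` and `χ` (mod `n`) does NOT factor through `d ∣ n`, then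
  `∑_a χ(a) ζ^{a} = 0` (Mathlib's `factorsThrough_of_gaussSum_ne_zero` for the additive character `zmodChar n`);
* `gaussSum_changeLevel_zmodChar` — LEVEL RAISING: for `χ₀` mod `p^M` (`1 ≤ M ≤ N`) and `ζ^{p^M} = 1`,
  `∑_{a mod p^N} χ₀(a) ζ^a = p^{N−M} · ∑_{b mod p^M} χ₀(b) ζ^b` (every fibre of `ℤ/p^N → ℤ/p^M` has `p^{N−M}` elements and units
  correspond to units);
* `gaussSum_zmodChar_eq_zero_of_factorsThrough` — VANISHING OF IMPRIMITIVE GAUSS SUMS: if `χ` mod `p^M` factors through `p^c`,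
  `1 ≤ c < M`, and `ζ^{p^c} ≠ 1 = ζ^{p^M}`, then `∑_{a mod p^M} χ(a) ζ^a = 0` (shift `a ↦ a + p^c`);
* `gaussSum_one_zmodChar_eq_zero` / `gaussSum_one_zmodChar_prime` — the trivial character: `0` at level `p^M`, `M ≥ 2`, for `ζ` of
  exact order `> p`… (precisely: `ζ^{p} ≠ 1`), and `−1` at level `p` for a primitive `p`-th root (Ramanujan sums).
The sequel assembles them into the `ℓ_m`-character sums (Kobayashi Prop. 8.26 at `2`).

References: [Kobayashi2003] Prop. 8.26 and §8.6 (pp. 24–25); [Washington1997] Lemma 4.7–4.8 (Gauss sums of imprimitive characters).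
-/

set_option autoImplicit false
-- the Theorems namespace of this sub repeats the summit name by design (D-0017 nested layout)
set_option linter.dupNamespace false

noncomputable section

open scoped Classical

open DirichletCharacter AddChar Finset

namespace Summit.BirchSwinnertonDyer.BirchSwinnertonDyer.Theorems.SignedKatoOffTwo.HondaLogChi

variable {R : Type*} [CommRing R]

/-! ## §1 Level lowering: `χ` not factoring through the level of `ζ` -/

/-- The additive character `a ↦ ζ^a` of `ℤ/n` is trivial on `d·ℤ/n` when `ζ^d = 1`. [folklore] -/
theorem mulShift_zmodChar_eq_one {n d : ℕ} [NeZero n] {ζ : R} (hζn : ζ ^ n = 1) (hζd : ζ ^ d = 1) :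
    (zmodChar n hζn).mulShift (d : ZMod n) = 1 := by
  ext a
  rw [mulShift_apply, one_apply, ← ZMod.natCast_zmod_val a, ← Nat.cast_mul, zmodChar_apply', pow_mul, hζd, one_pow]

/-- **If `χ` (mod `n`) does not factor through `d ∣ n` and `ζ^d = 1`, then `∑_a χ(a) ζ^a = 0`.**
(Contrapositive of Mathlib's `factorsThrough_of_gaussSum_ne_zero`.) [cite: Washington1997, Lemma 4.7] -/
theorem gaussSum_zmodChar_eq_zero_of_not_factorsThrough [IsDomain R] {n d : ℕ} [NeZero n] (hd : d ∣ n)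
    {χ : DirichletCharacter R n} (hχ : ¬ χ.FactorsThrough d) {ζ : R} (hζn : ζ ^ n = 1) (hζd : ζ ^ d = 1) :
    gaussSum χ (zmodChar n hζn) = 0 := by
  by_contra h
  exact hχ (factorsThrough_of_gaussSum_ne_zero (zmodChar n hζn) hd (mulShift_zmodChar_eq_one hζn hζd) h)

/-! ## §2 Level raising: `χ = χ₀ ∘ (ℤ/p^N → ℤ/p^M)` -/

section PrimePow

variable {p : ℕ} [hp : Fact p.Prime]

/-- For `1 ≤ M ≤ N`, a class mod `p^N` is a unit iff its image mod `p^M` is. [folklore] -/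
theorem isUnit_cast_iff {M N : ℕ} (hM : 1 ≤ M) (hMN : M ≤ N) (a : ZMod (p ^ N)) :
    IsUnit (ZMod.cast a : ZMod (p ^ M)) ↔ IsUnit a := by
  conv_rhs => rw [← ZMod.natCast_zmod_val a]
  rw [ZMod.cast_eq_val, ZMod.isUnit_natCast_iff_not_dvd_pow hp.out (by omega : 0 < M),
    ZMod.isUnit_natCast_iff_not_dvd_pow hp.out (by omega : 0 < N)]

/-- `changeLevel` at prime-power levels, evaluated on ALL of `ℤ/p^N` (MulChar convention `0` off units):
`(changeLevel χ₀) a = χ₀ (a mod p^M)` for `1 ≤ M ≤ N`. [folklore] -/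
theorem changeLevel_apply_primePow {M N : ℕ} (hM : 1 ≤ M) (hMN : M ≤ N) (χ₀ : DirichletCharacter R (p ^ M))
    (a : ZMod (p ^ N)) :
    changeLevel (pow_dvd_pow p hMN) χ₀ a = χ₀ (ZMod.cast a : ZMod (p ^ M)) := by
  by_cases ha : IsUnit a
  · rw [← ha.unit_spec, changeLevel_eq_cast_of_dvd χ₀ (pow_dvd_pow p hMN) ha.unit]
  · rw [MulChar.map_nonunit _ ha, MulChar.map_nonunit _ (mt (isUnit_cast_iff hM hMN a).mp ha)]

/-- `ζ^{a} = ζ^{a mod p^M}` on `ℤ/p^N` when `ζ^{p^M} = 1`. [folklore] -/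
theorem pow_val_eq_pow_val_cast {M N : ℕ} [NeZero (p ^ M)] {ζ : R} (hζ : ζ ^ p ^ M = 1) (a : ZMod (p ^ N)) :
    ζ ^ a.val = ζ ^ (ZMod.cast a : ZMod (p ^ M)).val := by
  rw [ZMod.cast_eq_val, ZMod.val_natCast, ← pow_eq_pow_mod _ hζ]

/-- **Level raising for Gauss sums at prime-power level.** For `χ₀` mod `p^M`, `1 ≤ M ≤ N`, and `ζ^{p^M} = 1`:
`∑_{a mod p^N} χ₀(a) ζ^a = p^{N−M} · ∑_{b mod p^M} χ₀(b) ζ^b`. [cite: Washington1997, Lemma 4.8] -/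
theorem gaussSum_changeLevel_zmodChar {M N : ℕ} (hM : 1 ≤ M) (hMN : M ≤ N) (χ₀ : DirichletCharacter R (p ^ M)) {ζ : R}
    (hζN : ζ ^ p ^ N = 1) (hζM : ζ ^ p ^ M = 1) :
    gaussSum (changeLevel (pow_dvd_pow p hMN) χ₀) (zmodChar (p ^ N) hζN) =
      (p ^ (N - M) : ℕ) * gaussSum χ₀ (zmodChar (p ^ M) hζM) := by
  -- the summand only depends on `a mod p^M`
  set π : ZMod (p ^ N) →+* ZMod (p ^ M) := ZMod.castHom (pow_dvd_pow p hMN) (ZMod (p ^ M)) with hπ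
  set F : ZMod (p ^ M) → R := fun b ↦ χ₀ b * zmodChar (p ^ M) hζM b with hF
  have hsummand : ∀ a : ZMod (p ^ N),
      changeLevel (pow_dvd_pow p hMN) χ₀ a * zmodChar (p ^ N) hζN a = F (π a) := by
    intro a
    simp only [hF, hπ, ZMod.castHom_apply, zmodChar_apply]
    rw [changeLevel_apply_primePow hM hMN, pow_val_eq_pow_val_cast hζM a]
  rw [gaussSum, gaussSum, Finset.sum_congr rfl fun a _ ↦ hsummand a]
  -- every fibre of `π` has `p^(N-M)` elements
  have hsurj : Function.Surjective π := ZMod.castHom_surjective (pow_dvd_pow p hMN)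
  have hfib : ∀ b : ZMod (p ^ M), #{a : ZMod (p ^ N) | π a = b} = p ^ (N - M) := by
    have hconst : ∀ b b' : ZMod (p ^ M), #{a : ZMod (p ^ N) | π a = b} = #{a : ZMod (p ^ N) | π a = b'} :=
      fun b b' ↦ AddMonoidHom.card_fiber_eq_of_mem_range (π : ZMod (p ^ N) →+ ZMod (p ^ M)) (hsurj b) (hsurj b')
    have htot : Fintype.card (ZMod (p ^ N)) = ∑ b : ZMod (p ^ M), #{a : ZMod (p ^ N) | π a = b} :=
      Finset.card_eq_sum_card_fiberwise (f := π) (s := Finset.univ) (t := Finset.univ) fun _ _ ↦ Finset.mem_univ _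
    intro b
    rw [Finset.sum_congr rfl fun b' _ ↦ hconst b' b, Finset.sum_const, smul_eq_mul, Finset.card_univ,
      ZMod.card, ZMod.card] at htot
    have h2 : p ^ M * #{a : ZMod (p ^ N) | π a = b} = p ^ M * p ^ (N - M) := by
      rw [← htot, ← pow_add, Nat.add_sub_cancel' hMN]
    exact Nat.eq_of_mul_eq_mul_left (pow_pos hp.out.pos M) h2
  rw [← Finset.sum_fiberwise_of_maps_to (g := π) (t := Finset.univ) (fun _ _ ↦ Finset.mem_univ _)]
  rw [Finset.mul_sum]
  refine Finset.sum_congr rfl fun b _ ↦ ?_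
  rw [Finset.sum_congr rfl fun a (ha : a ∈ ({a ∈ Finset.univ | π a = b} : Finset _)) ↦ by
    rw [(Finset.mem_filter.mp ha).2], Finset.sum_const, hfib b, nsmul_eq_mul]

/-! ## §3 Vanishing of imprimitive Gauss sums at prime-power level -/

/-- **An imprimitive Gauss sum vanishes**: if `χ` mod `p^M` factors through `p^c` with `1 ≤ c < M`, and `ζ^{p^M} = 1 ≠ ζ^{p^c}`, then
`∑_{a mod p^M} χ(a) ζ^a = 0` — the shift `a ↦ a + p^c` preserves `χ` and multiplies `ζ^a` by `ζ^{p^c} ≠ 1`.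
[cite: Washington1997, Lemma 4.8] -/
theorem gaussSum_zmodChar_eq_zero_of_factorsThrough [IsDomain R] {c M : ℕ} (hc : 1 ≤ c) (hcM : c ≤ M)
    {χ : DirichletCharacter R (p ^ M)} (hχ : χ.FactorsThrough (p ^ c)) {ζ : R} (hζM : ζ ^ p ^ M = 1)
    (hζc : ζ ^ p ^ c ≠ 1) : gaussSum χ (zmodChar (p ^ M) hζM) = 0 := by
  obtain ⟨hdvd, χ₀, rfl⟩ := hχ
  set t : ZMod (p ^ M) := ((p ^ c : ℕ) : ZMod (p ^ M)) with ht
  -- `χ (a + p^c) = χ a`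
  have hχt : ∀ a : ZMod (p ^ M), changeLevel hdvd χ₀ (a + t) = changeLevel hdvd χ₀ a := by
    intro a
    rw [show hdvd = pow_dvd_pow p hcM from rfl, changeLevel_apply_primePow hc hcM, changeLevel_apply_primePow hc hcM,
      ZMod.cast_add (pow_dvd_pow p hcM), ht, ZMod.cast_natCast (pow_dvd_pow p hcM), ZMod.natCast_self, add_zero]
  -- `ζ^(a + p^c) = ζ^a · ζ^(p^c)`
  have hζt : ∀ a : ZMod (p ^ M), zmodChar (p ^ M) hζM (a + t) = zmodChar (p ^ M) hζM a * ζ ^ p ^ c := by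
    intro a
    rw [map_add_eq_mul, ht, zmodChar_apply']
  have hshift : gaussSum (changeLevel hdvd χ₀) (zmodChar (p ^ M) hζM) =
      gaussSum (changeLevel hdvd χ₀) (zmodChar (p ^ M) hζM) * ζ ^ p ^ c := by
    conv_lhs => rw [gaussSum, ← Equiv.sum_comp (Equiv.addRight t)]
    simp only [Equiv.coe_addRight, hχt, hζt, ← mul_assoc, ← Finset.sum_mul, gaussSum]
  have h1 : gaussSum (changeLevel hdvd χ₀) (zmodChar (p ^ M) hζM) * (ζ ^ p ^ c - 1) = 0 := by
    rw [mul_sub, mul_one, ← hshift, sub_self]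
  exact (mul_eq_zero.mp h1).resolve_right (sub_ne_zero.mpr hζc)

/-! ## §4 The trivial character (Ramanujan sums at prime powers) -/

/-- For `M ≥ 2`... precisely: if `ζ^{p^M} = 1` but `ζ^p ≠ 1` (`M ≥ 1`), the trivial character mod `p^M` has
`∑_{a unit mod p^M} ζ^a = 0`. [cite: Washington1997, Lemma 4.8] -/
theorem gaussSum_one_zmodChar_eq_zero [IsDomain R] {M : ℕ} (hM : 1 ≤ M) {ζ : R} (hζM : ζ ^ p ^ M = 1) (hζ1 : ζ ^ p ≠ 1) :
    gaussSum (1 : DirichletCharacter R (p ^ M)) (zmodChar (p ^ M) hζM) = 0 := by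
  have h1 : (1 : DirichletCharacter R (p ^ M)).FactorsThrough (p ^ 1) :=
    ⟨pow_dvd_pow p hM, 1, (changeLevel_one _).symm⟩
  exact gaussSum_zmodChar_eq_zero_of_factorsThrough le_rfl hM h1 hζM (by rwa [pow_one])

/-- At level `p`: for a primitive `p`-th root of unity `ζ`, `∑_{a unit mod p} ζ^a = −1` (the class `0` is the only non-unit
and `∑_{a mod p} ζ^a = 0`). [folklore] -/
theorem gaussSum_one_zmodChar_prime [IsDomain R] {ζ : R} (hζ : IsPrimitiveRoot ζ p) (hζ1 : ζ ^ p ^ 1 = 1) :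
    gaussSum (1 : DirichletCharacter R (p ^ 1)) (zmodChar (p ^ 1) hζ1) = -1 := by
  have hp1 : p ^ 1 = p := pow_one p
  haveI : Fact (1 < p ^ 1) := ⟨by rw [hp1]; exact hp.out.one_lt⟩
  -- the sum over ALL classes vanishes
  have hall : ∑ a : ZMod (p ^ 1), ζ ^ a.val = 0 := by
    rw [show ∑ a : ZMod (p ^ 1), ζ ^ a.val = ∑ j ∈ Finset.range (p ^ 1), ζ ^ j from
      Finset.sum_nbij' (fun a ↦ a.val) (fun j ↦ (j : ZMod (p ^ 1))) (fun a _ ↦ Finset.mem_range.mpr (ZMod.val_lt a))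
        (fun j _ ↦ Finset.mem_univ _) (fun a _ ↦ ZMod.natCast_zmod_val a)
        (fun j hj ↦ by rw [ZMod.val_natCast, Nat.mod_eq_of_lt (Finset.mem_range.mp hj)]) (fun a _ ↦ rfl),
      hp1]
    exact hζ.geom_sum_eq_zero hp.out.one_lt
  -- the class `0` contributes `ζ^0 = 1` to `hall` and `0` to the Gauss sum; every other class is a unit
  rw [← Finset.sum_erase_add _ _ (Finset.mem_univ (0 : ZMod (p ^ 1))), ZMod.val_zero, pow_zero] at hall
  rw [gaussSum, ← Finset.sum_erase_add _ _ (Finset.mem_univ (0 : ZMod (p ^ 1))), MulChar.map_zero, zero_mul,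
    add_zero]
  have hunits : ∀ a ∈ Finset.univ.erase (0 : ZMod (p ^ 1)),
      (1 : DirichletCharacter R (p ^ 1)) a * zmodChar (p ^ 1) hζ1 a = ζ ^ a.val := by
    intro a ha
    have ha0 : a ≠ 0 := Finset.ne_of_mem_erase ha
    have hu : IsUnit a := by
      rw [← ZMod.natCast_zmod_val a, ZMod.isUnit_natCast_iff_not_dvd_pow hp.out Nat.one_pos]
      intro hdvd
      exact ha0 ((ZMod.val_eq_zero a).mp (Nat.eq_zero_of_dvd_of_lt hdvd (lt_of_lt_of_eq (ZMod.val_lt a) hp1)))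
    rw [MulChar.one_apply hu, one_mul, zmodChar_apply]
  rw [Finset.sum_congr rfl hunits]
  exact eq_neg_of_add_eq_zero_left hall

end PrimePow

end Summit.BirchSwinnertonDyer.BirchSwinnertonDyer.Theorems.SignedKatoOffTwo.HondaLogChi

end
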